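import Summits.QuantumFields.QCD.Theses.NestedDissectionSea
import Summits.QuantumFields.QCD.Theorems.CoerciveSea.Negative.PinWindow

/-!
# Route `NestedDissectionSea`, support `CoerciveOfDilute` (stmt-QuantumFields-14759) — the ∃-alignment

`CoerciveOfDilute : NegativeCellsDilute → CoerciveSea` is the glue from the tier-deciding crux
(clauses (ii) windowed local dilution + (iii) parity pin, behind `∃ reg M₀ b₀ ℓ`) to the hinge
((i) separator Wegner law in the window + (ii) + (iii), behind its own `∃ reg M₀ b₀ ℓ`). Its content
is crux-grade (it IS clause (i) of `CoerciveSea`, to be supplied along the dilution-certified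
regularisation); this file does not claim it. It records, sorry-free, exactly what a proof must and
need only supply, and how the two existential prefixes are aligned:

* `coerciveOfDilute_of_coerciveSea` — the item is dominated by the hinge (one line): any proof of
  `CoerciveSea` (stmt-QuantumFields-13901) closes it.
* `coerciveOfDilute_of_separatorWegnerLaw` — THE REDUCTION. It suffices to prove, for every
  `N_f ∈ {2,3}` and every admissible `reg` (`HasMassScaling`, `HasAsymptoticScaling`) and data
  `M₀ ≥ 0`, `b₀ ≥ 2`, `ℓ > 0` carrying the body of `NegativeCellsDilute`, the separator law (i) for the
  SAME `reg` and `b₀` but with every other freedom the hinge tolerates: an arbitrary valence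
  threshold `M₁`, an arbitrary (smaller or larger) physical window `ℓ₁ > 0`, per mass tuple its own
  physical size `R`, constant `C`, exponent `α > 0`, and the law only for levels `t ≤ t₀` (`t₀ > 0`
  arbitrary). The proof aligns the prefixes: threshold `max M₀ M₁`, window `min ℓ ℓ₁`, size
  `max (max R₀ R) ℓ`; (ii) transfers DOWN in the window (`dilution_mono`: below the window depth every
  dyadic scale carries an admissible box, so the hypothesis' `δ_j` are `≥ 0` and the shorter sum is
  `≤ ε`), (iii) transfers UP in `M₀, R` (`pin_mono`), and (i) extends from `t ≤ t₀` to `t ≤ 1` because a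
  phase-quenched ratio is `≤ 1` (`quenchedRatio_le_one`).
* The hypothesis of the reduction is, clause for clause, what the picked line of crux 13901
  (`Cruxes/CoerciveSea/Lines/chirality_collapses_pseudospectrum.lean`) produces from its stubs
  `sheetPileupOfSingularSeparator`, `censusDominates`, `chiralPileupRareOfPinned`,
  `achiralPileupRareOfPinned` WITHOUT its import stub `pinnedDilution : NegativeCellsDilute` — so those
  four stubs close this item before (and independently of) stmt-13900.

Why no cheaper proof exists (census of this seat, all provable from landed negatives): the pin (iii)
forces `mcrit k − a_k M/Z_m k ∈ (−8, 0)` eventually (`CoerciveSeaNegative.PinClause.mass_mem_Ioo`), so the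
valence masses are NOT in the vacuity range `μ ≥ 1/2` of `hasSingularSeparator_mass_lt`; `b₀` cannot be
changed (the leaf clause of `IsSignDefect` is indexed by the dyadic scale); shrinking the window does
not bound the lattice size `ℓ₁/a_k → ∞` of the boxes in (i). Standard material. [folklore]
-/

noncomputable section

open scoped BigOperators Classical
open MeasureTheory Filter Matrix
open Literature.MathematicalPhysics.QuantumLattice Literature.MathematicalPhysics.QuantumFieldTheory
  Literature.Probability.LatticeModels
open Summit.QuantumFields.QCD.Theses.NestedDissectionSea
open Summit.QuantumFields.QCD.Theorems.CoerciveSeaNegative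

namespace Summit.QuantumFields.QCD.Theorems.NestedDissectionSeaCoerciveOfDilute

/-! ## 0. The item is dominated by the hinge -/

/-- **`CoerciveSea → CoerciveOfDilute`**: any proof of the hinge (stmt-QuantumFields-13901) closes
the glue item trivially (the hypothesis `NegativeCellsDilute` is then not needed). [folklore] -/
theorem coerciveOfDilute_of_coerciveSea (h : CoerciveSea) : CoerciveOfDilute :=
  fun _ => h

/-! ## 1. A phase-quenched ratio lies in `[0, 1]` -/

section Ratio

variable {Ω : Type*} [MeasurableSpace Ω]

/-- The phase-quenched probability `(∫ 1_E · wt) / (∫ wt)` of any event under a non-negative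
weight is `≥ 0` (Bochner integrals of non-negative functions are non-negative; `x / 0 = 0`).
[folklore] -/
theorem quenchedRatio_nonneg (μ : Measure Ω) {wt : Ω → ℝ} (hwt : ∀ U, 0 ≤ wt U) (E : Ω → Prop) :
    0 ≤ (∫ U, (if E U then (1 : ℝ) else 0) * wt U ∂μ) / (∫ U, wt U ∂μ) :=
  div_nonneg (integral_nonneg fun U => mul_nonneg (by split_ifs <;> norm_num) (hwt U))
    (integral_nonneg hwt)

/-- The phase-quenched probability `(∫ 1_E · wt) / (∫ wt)` of any event under a non-negative
weight is `≤ 1`: if the weight is integrable the numerator is dominated by the denominator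
(`integral_mono_of_nonneg`, no measurability of `E` needed), otherwise the denominator is the
Bochner junk `0` and the ratio is `0`. [folklore] -/
theorem quenchedRatio_le_one (μ : Measure Ω) {wt : Ω → ℝ} (hwt : ∀ U, 0 ≤ wt U) (E : Ω → Prop) :
    (∫ U, (if E U then (1 : ℝ) else 0) * wt U ∂μ) / (∫ U, wt U ∂μ) ≤ 1 := by
  by_cases hint : Integrable wt μ
  · refine div_le_one_of_le₀ ?_ (integral_nonneg hwt)
    refine integral_mono_of_nonneg (Eventually.of_forall fun U => ?_) hint
      (Eventually.of_forall fun U => ?_)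
    · exact mul_nonneg (by split_ifs <;> norm_num) (hwt U)
    · show (if E U then (1 : ℝ) else 0) * wt U ≤ wt U
      split_ifs
      · rw [one_mul]
      · rw [zero_mul]; exact hwt U
  · rw [integral_undef hint, div_zero]
    exact zero_le_one

end Ratio

/-! ## 2. Window arithmetic: depth is monotone, every scale below the depth carries a box -/

/-- The window depth `J = log₂(⌊ℓ/a⌋ / b₀) + 1` is monotone in the physical window `ℓ`.
[folklore] -/
theorem windowDepth_mono {a ℓ ℓ' : ℝ} (ha : 0 < a) (hℓ : ℓ' ≤ ℓ) (b₀ : ℕ) :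
    Nat.log 2 (⌊ℓ' / a⌋₊ / b₀) + 1 ≤ Nat.log 2 (⌊ℓ / a⌋₊ / b₀) + 1 :=
  Nat.succ_le_succ (Nat.log_mono_right (Nat.div_le_div_right
    (Nat.floor_le_floor (div_le_div_of_nonneg_right hℓ ha.le))))

/-- **Every dyadic scale below the window depth carries an admissible box.** If the leaf fits
(`b₀ a ≤ ℓ`) and the torus is at least one window wide (`ℓ ≤ a N`), then for `j < J` the cube of
side `b₀ 2^j` satisfies the box constraints of clause (ii): `b₀ 2^j < b₀ 2^(j+2)`, `b₀ 2^j ≤ N`,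
`b₀ 2^j · a ≤ ℓ` (from `2^j ≤ 2^{log₂ q} ≤ q = ⌊ℓ/a⌋/b₀` and `b₀ q ≤ ⌊ℓ/a⌋ ≤ ℓ/a ≤ N`). [folklore] -/
theorem scaleBox_admissible {a ℓ : ℝ} (ha : 0 < a) {b₀ : ℕ} (hb₀ : 0 < b₀) (hbℓ : (b₀ : ℝ) * a ≤ ℓ)
    {N : ℕ} (hN : ℓ ≤ a * N) {j : ℕ} (hj : j < Nat.log 2 (⌊ℓ / a⌋₊ / b₀) + 1) :
    b₀ * 2 ^ j < b₀ * 2 ^ (j + 2) ∧ b₀ * 2 ^ j ≤ N ∧ ((b₀ * 2 ^ j : ℕ) : ℝ) * a ≤ ℓ := by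
  have hfloor : b₀ ≤ ⌊ℓ / a⌋₊ := Nat.le_floor (by rwa [le_div_iff₀ ha])
  have hq : 0 < ⌊ℓ / a⌋₊ / b₀ := Nat.div_pos hfloor hb₀
  have hj' : j ≤ Nat.log 2 (⌊ℓ / a⌋₊ / b₀) := Nat.lt_succ_iff.mp hj
  have hpow : 2 ^ j ≤ ⌊ℓ / a⌋₊ / b₀ :=
    (Nat.pow_le_pow_right (by norm_num) hj').trans (Nat.pow_log_le_self 2 hq.ne')
  have hn : b₀ * 2 ^ j ≤ ⌊ℓ / a⌋₊ :=
    (Nat.mul_le_mul_left b₀ hpow).trans (Nat.mul_div_le _ _)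
  have hℓa : 0 ≤ ℓ / a := div_nonneg ((mul_nonneg b₀.cast_nonneg ha.le).trans hbℓ) ha.le
  have hnreal : ((b₀ * 2 ^ j : ℕ) : ℝ) ≤ ℓ / a :=
    (Nat.cast_le.mpr hn).trans (Nat.floor_le hℓa)
  refine ⟨?_, ?_, ?_⟩
  · exact Nat.mul_lt_mul_of_pos_left (Nat.pow_lt_pow_right (by norm_num) (by omega)) hb₀
  · have h : ((b₀ * 2 ^ j : ℕ) : ℝ) ≤ N := hnreal.trans (by rwa [div_le_iff₀' ha])
    exact_mod_cast h
  · rwa [le_div_iff₀ ha] at hnreal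

/-! ## 3. Monotonicity of clauses (ii) and (iii) in the existential data -/

/-- **Clause (ii) (windowed local dilution) transfers to a smaller window and a larger physical
size.** VERBATIM the dilution clause of `NegativeCellsDilute` / `CoerciveSea` for the data
`(reg, b₀, ℓ, m, R)` implies the same clause for `(reg, b₀, ℓ', m, R')` whenever `0 < ℓ' ≤ ℓ`,
`R ≤ R'` and `ℓ ≤ R'`. Proof: eventually `b₀ a_k ≤ ℓ'`; on a torus of physical side `≥ R' ≥ ℓ` every
scale `j < J(ℓ)` carries an admissible box (`scaleBox_admissible`), whose phase-quenched defect
probability is `≥ 0`, so the hypothesis' `δ_j ≥ 0` for `j < J(ℓ)`; keep the same `δ`: the shorter sum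
over `j < J(ℓ') ≤ J(ℓ)` is `≤ ε`, and boxes of the smaller window are boxes of the larger. [folklore] -/
theorem dilution_mono {Nf : ℕ} (reg : QCDRegularisation Nf) {b₀ : ℕ} (hb₀ : 2 ≤ b₀)
    {ℓ ℓ' R R' : ℝ} (hℓ' : 0 < ℓ') (hℓℓ : ℓ' ≤ ℓ) (hRR : R ≤ R') (hℓR : ℓ ≤ R') (m : Fin Nf → ℝ)
    (h : ∀ ε : ℝ, 0 < ε → ∀ᶠ k : ℕ in Filter.atTop, ∀ S : ℕ, R ≤ reg.a k * (2 * S + 1) → let N : ℕ := 2 * S + 1; let mq : Fin Nf → ℝ := fun f => reg.mcrit k + reg.a k * m f / reg.Zm k; let wt : GaugeConfig 4 N (Matrix.specialUnitaryGroup (Fin 3) ℂ) → ℝ := fun U => ∏ f, ‖fermionDet (wilsonDirac (fundamentalRep (Fin 3)) U (mq f) 1)‖; let P : (GaugeConfig 4 N (Matrix.specialUnitaryGroup (Fin 3) ℂ) → Prop) → ℝ := fun E => (∫ U, (if E U then (1 : ℝ) else 0) * wt U ∂(wilsonMeasure (d := 4) (L := N) (fundamentalRep (Fin 3)) (reg.β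 k))) / (∫ U, wt U ∂(wilsonMeasure (d := 4) (L := N) (fundamentalRep (Fin 3)) (reg.β k))); let J : ℕ := Nat.log 2 (⌊ℓ / reg.a k⌋₊ / b₀) + 1; ∃ δ : ℕ → ℝ, ∑ j ∈ Finset.range J, δ j ≤ ε ∧ ∀ j < J, ∀ s : Fin 4 → ℕ, (∀ i, b₀ * 2 ^ j ≤ s i ∧ s i < b₀ * 2 ^ (j + 2) ∧ s i ≤ N ∧ (s i : ℝ) * reg.a k ≤ ℓ) → P (fun U => ∃ f, IsSignDefect U (mq f) j s) ≤ δ j) :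
    ∀ ε : ℝ, 0 < ε → ∀ᶠ k : ℕ in Filter.atTop, ∀ S : ℕ, R' ≤ reg.a k * (2 * S + 1) → let N : ℕ := 2 * S + 1; let mq : Fin Nf → ℝ := fun f => reg.mcrit k + reg.a k * m f / reg.Zm k; let wt : GaugeConfig 4 N (Matrix.specialUnitaryGroup (Fin 3) ℂ) → ℝ := fun U => ∏ f, ‖fermionDet (wilsonDirac (fundamentalRep (Fin 3)) U (mq f) 1)‖; let P : (GaugeConfig 4 N (Matrix.specialUnitaryGroup (Fin 3) ℂ) → Prop) → ℝ := fun E => (∫ U, (if E U then (1 : ℝ) else 0) * wt U ∂(wilsonMeasure (d := 4) (L := N) (fundamentalRep (Fin 3)) (reg.β k))) / (∫ U, wt U ∂(wilsonMeasure (d := 4) (L := N) (fundamentalRep (Fin 3)) (reg.β k))); let J : ℕ := Nat.log 2 (⌊ℓ' / reg.a k⌋₊ / b₀) + 1; ∃ δ : ℕ → ℝ, ∑ j ∈ Finset.range J, δ j ≤ ε ∧ ∀ j < J, ∀ s : Fin 4 → ℕ, (∀ i, b₀ * 2 ^ j ≤ s i ∧ s i < b₀ * 2 ^ (j + 2) ∧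 s i ≤ N ∧ (s i : ℝ) * reg.a k ≤ ℓ') → P (fun U => ∃ f, IsSignDefect U (mq f) j s) ≤ δ j := by
  intro ε hε
  have hb₀pos : 0 < b₀ := lt_of_lt_of_le (by norm_num) hb₀
  have hb₀real : (0 : ℝ) < b₀ := by exact_mod_cast hb₀pos
  have hsmall : ∀ᶠ k : ℕ in Filter.atTop, reg.a k < ℓ' / b₀ :=
    reg.tendsto_a.eventually (gt_mem_nhds (div_pos hℓ' hb₀real))
  filter_upwards [h ε hε, hsmall] with k hk hak
  intro S hS
  have ha := reg.a_pos k
  have hk' := hk S (hRR.trans hS)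
  dsimp only at hk' ⊢
  obtain ⟨δ, hsum, hδ⟩ := hk'
  -- the leaf fits in the hypothesis' window and the torus is one window wide
  have hbℓ : (b₀ : ℝ) * reg.a k ≤ ℓ := by
    have h1 : reg.a k * b₀ < ℓ' := (lt_div_iff₀ hb₀real).mp hak
    nlinarith
  have hN : ℓ ≤ reg.a k * ((2 * S + 1 : ℕ) : ℝ) := by
    push_cast
    exact hℓR.trans hS
  -- hence every `δ j`, `j < J(ℓ)`, dominates a genuine probability and is `≥ 0`
  have hδnonneg : ∀ j ∈ Finset.range (Nat.log 2 (⌊ℓ / reg.a k⌋₊ / b₀) + 1), 0 ≤ δ j := by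
    intro j hj
    rw [Finset.mem_range] at hj
    obtain ⟨hlt, hle, hwin⟩ := scaleBox_admissible ha hb₀pos hbℓ hN hj
    have hbox := hδ j hj (fun _ => b₀ * 2 ^ j) fun i => ⟨le_rfl, hlt, hle, hwin⟩
    exact le_trans (quenchedRatio_nonneg _ (fun U => Finset.prod_nonneg fun f _ => norm_nonneg _) _)
      hbox
  refine ⟨δ, ?_, ?_⟩
  · -- the shorter sum of non-negative terms is still `≤ ε`
    refine le_trans (Finset.sum_le_sum_of_subset_of_nonneg
      (Finset.range_subset_range.mpr (windowDepth_mono ha hℓℓ b₀)) fun j hj _ => hδnonneg j hj) hsum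
  · -- boxes of the smaller window are boxes of the larger window
    intro j hj s hs
    exact hδ j (lt_of_lt_of_le hj (windowDepth_mono ha hℓℓ b₀)) s
      fun i => ⟨(hs i).1, (hs i).2.1, (hs i).2.2.1, (hs i).2.2.2.trans hℓℓ⟩

/-- **Clause (iii) (the parity pin) transfers to a larger threshold and a larger physical size**:
`PinClause Nf reg M₀ m R → PinClause Nf reg M₀' m R'` for `M₀ ≤ M₀'`, `R ≤ R'` (fewer probe masses,
fewer tori). [folklore] -/
theorem pin_mono {Nf : ℕ} {reg : QCDRegularisation Nf} {M₀ M₀' : ℝ} {m : Fin Nf → ℝ} {R R' : ℝ}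
    (h : PinClause Nf reg M₀ m R) (hM : M₀ ≤ M₀') (hR : R ≤ R') : PinClause Nf reg M₀' m R' := by
  intro M hM'
  filter_upwards [h M (lt_of_le_of_lt hM hM')] with k hk S hS
  exact hk S (hR.trans hS)

/-! ## 4. The reduction: the separator Wegner law along the dilution-certified regularisation suffices -/

/-- **THE REDUCTION (`∃`-alignment of `CoerciveOfDilute`).** Suppose that for every `N_f ∈ {2,3}`,
every mass-independent regularisation `reg` with `HasMassScaling` and `HasAsymptoticScaling`, and
all data `M₀ ≥ 0`, `b₀ ≥ 2`, `ℓ > 0` carrying the BODY of `NegativeCellsDilute` (every mass tuple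
`m > M₀` has a physical size `R` with (ii) windowed local dilution and (iii) the parity pin —
verbatim), the SEPARATOR WEGNER LAW holds along the same `reg` and leaf size `b₀` in the following
weak form: there are a valence threshold `M₁` and a physical window `ℓ₁ > 0` (both arbitrary) such
that every mass tuple `m > M₁` has `R, C`, an exponent `α > 0` and a level cap `t₀ > 0` with,
eventually in `k`, on every odd torus of physical side `≥ R`, for every roughly cubic corner-`0` box
with `b₀ ≤ s_i ≤ 2S+1`, `s_i a_k ≤ ℓ₁`, every flavour `f` and every `t ∈ (0, t₀]`:
`P_pq(HasSingularSeparator U m_f(k) s (t/s₀)) ≤ C t^α` (`P_pq` the crux's phase-quenched ratio at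
`β_k`). THEN `CoerciveOfDilute : NegativeCellsDilute → CoerciveSea`. Proof: unpack the hypothesis'
witness `(reg, M₀, b₀, ℓ)`, feed its body to the law, and witness the hinge by
`(reg, max M₀ M₁, b₀, min ℓ ℓ₁)` and, per mass tuple, `R' = max (max R₀ R) ℓ`,
`C' = max C 0 + (t₀^α)⁻¹`, `α`: clause (i) is the law on the boxes of the smaller window, extended to
`t ∈ (t₀, 1]` by `P_pq ≤ 1 ≤ (t/t₀)^α`; (ii) by `dilution_mono`; (iii) by `pin_mono`. [folklore] -/
theorem coerciveOfDilute_of_separatorWegnerLaw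
    (hW : ∀ (Nf : ℕ) (reg : QCDRegularisation Nf), (Nf = 2 ∨ Nf = 3) → reg.HasMassScaling →
      (reg.scheme 0 0 0).HasAsymptoticScaling → ∀ M₀ : ℝ, 0 ≤ M₀ → ∀ b₀ : ℕ, 2 ≤ b₀ → ∀ ℓ : ℝ, 0 < ℓ →
      (∀ m : Fin Nf → ℝ, (∀ f, M₀ < m f) → ∃ R : ℝ, 0 < R ∧ (∀ ε : ℝ, 0 < ε → ∀ᶠ k : ℕ in Filter.atTop, ∀ S : ℕ, R ≤ reg.a k * (2 * S + 1) → let N : ℕ := 2 * S + 1; let mq : Fin Nf → ℝ := fun f => reg.mcrit k + reg.a k * m f / reg.Zm k; let wt : GaugeConfig 4 N (Matrix.specialUnitaryGroup (Fin 3) ℂ) → ℝ := fun U => ∏ f, ‖fermionDet (wilsonDirac (fundamentalRep (Fin 3)) U (mq f) 1)‖; let P : (GaugeConfig 4 N (Matrix.specialUnitaryGroup (Fin 3) ℂ) → Prop) → ℝ := fun E => (∫ U, (if E U then (1 : ℝ) else 0) * wt U ∂(wilsonMeasure (d := 4) (L := N) (fundamentalRep (Fin 3)) (reg.β k))) / (∫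 U, wt U ∂(wilsonMeasure (d := 4) (L := N) (fundamentalRep (Fin 3)) (reg.β k))); let J : ℕ := Nat.log 2 (⌊ℓ / reg.a k⌋₊ / b₀) + 1; ∃ δ : ℕ → ℝ, ∑ j ∈ Finset.range J, δ j ≤ ε ∧ ∀ j < J, ∀ s : Fin 4 → ℕ, (∀ i, b₀ * 2 ^ j ≤ s i ∧ s i < b₀ * 2 ^ (j + 2) ∧ s i ≤ N ∧ (s i : ℝ) * reg.a k ≤ ℓ) → P (fun U => ∃ f, IsSignDefect U (mq f) j s) ≤ δ j) ∧ (∀ M : ℝ, M₀ < M → ∀ᶠ k : ℕ in Filter.atTop, ∀ S : ℕ, R ≤ reg.a k * (2 * S + 1) → let N : ℕ := 2 * S + 1; let mq : Fin Nf → ℝ := fun f => reg.mcrit k + reg.a k * m f / reg.Zm k; let wt : GaugeConfig 4 N (Matrix.specialUnitaryGroup (Fin 3) ℂ) → ℝ := fun U => ∏ f, ‖fermionDet (wilsonDirac (fundamentalRep (Fin 3)) U (mq f) 1)‖; (1 / 4 : ℝ) ≤ (∫ U, (if (fermionDet (wilsonDirac (fundamentalRep (Fin 3)) U (reg.mcrit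 k - reg.a k * M / reg.Zm k) 1)).re < 0 then (1 : ℝ) else 0) * wt U ∂(wilsonMeasure (d := 4) (L := N) (fundamentalRep (Fin 3)) (reg.β k))) / (∫ U, wt U ∂(wilsonMeasure (d := 4) (L := N) (fundamentalRep (Fin 3)) (reg.β k))))) →
      ∃ M₁ ℓ₁ : ℝ, 0 < ℓ₁ ∧ ∀ m : Fin Nf → ℝ, (∀ f, M₁ < m f) →
        ∃ R C α t₀ : ℝ, 0 < α ∧ 0 < t₀ ∧ ∀ᶠ k : ℕ in Filter.atTop, ∀ S : ℕ, R ≤ reg.a k * (2 * S + 1) →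
          let N : ℕ := 2 * S + 1
          let mq : Fin Nf → ℝ := fun f => reg.mcrit k + reg.a k * m f / reg.Zm k
          let wt : GaugeConfig 4 N (Matrix.specialUnitaryGroup (Fin 3) ℂ) → ℝ := fun U =>
            ∏ f, ‖fermionDet (wilsonDirac (fundamentalRep (Fin 3)) U (mq f) 1)‖
          let P : (GaugeConfig 4 N (Matrix.specialUnitaryGroup (Fin 3) ℂ) → Prop) → ℝ := fun E =>
            (∫ U, (if E U then (1 : ℝ) else 0) * wt U
                ∂(wilsonMeasure (d := 4) (L := N) (fundamentalRep (Fin 3)) (reg.β k))) /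
              (∫ U, wt U ∂(wilsonMeasure (d := 4) (L := N) (fundamentalRep (Fin 3)) (reg.β k)))
          ∀ s : Fin 4 → ℕ, (∀ i, b₀ ≤ s i ∧ s i ≤ N ∧ (s i : ℝ) * reg.a k ≤ ℓ₁) →
            (∀ i j, s i ≤ 2 * s j) → ∀ f : Fin Nf, ∀ t : ℝ, 0 < t → t ≤ t₀ →
              P (fun U => HasSingularSeparator U (mq f) s (t / s 0)) ≤ C * t ^ α) :
    CoerciveOfDilute := by
  intro hD Nf hNf
  obtain ⟨reg, hms, has, M₀, hM₀, b₀, hb₀, ℓ, hℓ, hm⟩ := hD Nf hNf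
  obtain ⟨M₁, ℓ₁, hℓ₁, hlaw⟩ := hW Nf reg hNf hms has M₀ hM₀ b₀ hb₀ ℓ hℓ hm
  refine ⟨reg, hms, has, max M₀ M₁, hM₀.trans (le_max_left _ _), b₀, hb₀, min ℓ ℓ₁, lt_min hℓ hℓ₁,
    fun m hmm => ?_⟩
  have hm₀ : ∀ f, M₀ < m f := fun f => (le_max_left _ _).trans_lt (hmm f)
  have hm₁ : ∀ f, M₁ < m f := fun f => (le_max_right _ _).trans_lt (hmm f)
  obtain ⟨R₀, hR₀, hDil, hPin⟩ := hm m hm₀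
  obtain ⟨Rw, C, α, t₀, hα, ht₀, hlawk⟩ := hlaw m hm₁
  have hR' : R₀ ≤ max (max R₀ Rw) ℓ := (le_max_left _ _).trans (le_max_left _ _)
  refine ⟨max (max R₀ Rw) ℓ, hR₀.trans_le hR', ?_, ?_, ?_⟩
  · -- clause (i): the law on the boxes of the smaller window, extended to all `t ∈ (0, 1]`
    have ht₀α : 0 < t₀ ^ α := Real.rpow_pos_of_pos ht₀ α
    refine ⟨max C 0 + (t₀ ^ α)⁻¹, add_pos_of_nonneg_of_pos (le_max_right _ _) (inv_pos.mpr ht₀α),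
      α, hα, ?_⟩
    filter_upwards [hlawk] with k hk
    intro S hS
    have hk' := hk S (((le_max_right _ _).trans (le_max_left _ _)).trans hS)
    dsimp only at hk' ⊢
    intro s hs hcub f t ht0 ht1
    have hs' : ∀ i, b₀ ≤ s i ∧ s i ≤ 2 * S + 1 ∧ (s i : ℝ) * reg.a k ≤ ℓ₁ := fun i =>
      ⟨(hs i).1, (hs i).2.1, (hs i).2.2.trans (min_le_right _ _)⟩
    have htα : 0 ≤ t ^ α := (Real.rpow_pos_of_pos ht0 α).le
    have hC0 : 0 ≤ max C 0 := le_max_right _ _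
    have hinv : 0 ≤ (t₀ ^ α)⁻¹ := (inv_pos.mpr ht₀α).le
    by_cases htt : t ≤ t₀
    · calc _ ≤ C * t ^ α := hk' s hs' hcub f t ht0 htt
        _ ≤ max C 0 * t ^ α := mul_le_mul_of_nonneg_right (le_max_left _ _) htα
        _ ≤ (max C 0 + (t₀ ^ α)⁻¹) * t ^ α := by nlinarith [mul_nonneg hinv htα]
    · have hpow : t₀ ^ α ≤ t ^ α := Real.rpow_le_rpow ht₀.le (not_le.mp htt).le hα.le
      calc _ ≤ (1 : ℝ) :=
            quenchedRatio_le_one _ (fun U => Finset.prod_nonneg fun f _ => norm_nonneg _) _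
        _ = (t₀ ^ α)⁻¹ * t₀ ^ α := (inv_mul_cancel₀ ht₀α.ne').symm
        _ ≤ (t₀ ^ α)⁻¹ * t ^ α := mul_le_mul_of_nonneg_left hpow hinv
        _ ≤ (max C 0 + (t₀ ^ α)⁻¹) * t ^ α := by nlinarith [mul_nonneg hC0 htα]
  · -- clause (ii): the hypothesis' dilution, moved down to the smaller window
    exact dilution_mono reg hb₀ (lt_min hℓ hℓ₁) (min_le_left _ _) hR' (le_max_right _ _) m hDil
  · -- clause (iii): the hypothesis' pin, restricted to larger `M₀` and `R`
    exact pin_mono hPin (le_max_left _ _) hR'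

/-! ## 5. In the currency of the picked line of crux 13901: its four non-import stubs close this item -/

/-- **`CoerciveOfDilute` from the four non-import stubs of line `chirality-collapses-pseudospectrum`
of crux `CoerciveSea` (stmt-QuantumFields-13901).** The hypotheses are, VERBATIM, the registered
stubs `stub_sheetPileupOfSingularSeparator` (a `τ`-singular separator piles sheet weight of low
modes of the Hermitian cell operator onto the valence mass), `stub_censusDominates` (chirality split
+ subadditivity of the phase-quenched ratio), `stub_chiralPileupRareOfPinned` (A″-law) and
`stub_achiralPileupRareOfPinned` (B″-law) of `Cruxes/CoerciveSea/Lines/chirality_collapses_pseudospectrum.lean`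
(registered on stmt-13901, 2026-08-16) — everything in that line's composition `CoerciveSea_of` EXCEPT
its import stub `stub_pinnedDilution : NegativeCellsDilute`, which here is the hypothesis of the
conclusion. Proof: feed the body of `NegativeCellsDilute` at the given `(reg, M₀, b₀, ℓ)` to the two
laws; the separator Wegner law required by `coerciveOfDilute_of_separatorWegnerLaw` holds with
`M₁ = max M₁ᴬ M₁ᴮ`, `ℓ₁ = ℓ`, `R = max Rᴬ Rᴮ`, `C = Cᴬ + Cᴮ`, `α = min αᴬ αᴮ`, `t₀ = 1` — pile-up
(stub 1) pointwise, domination (stub 2), the two laws, and `Cᴬ t^αᴬ + Cᴮ t^αᴮ ≤ (Cᴬ + Cᴮ) t^{min}` on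
`(0,1]`. So those four stubs close stmt-14759 before, and independently of, stmt-13900. [folklore] -/
theorem coerciveOfDilute_of_pileupLaws
    (h₁ : ∀ (N : ℕ) [NeZero N] (U : GaugeConfig 4 N (Matrix.specialUnitaryGroup (Fin 3) ℂ)) (s : Fin 4 → ℕ)
      (μ τ : ℝ), HasSingularSeparator U μ s τ → 0 < τ →
      ∃ n : ℕ, ∃ u : Fin n → ({p // wilsonBox (0 : TorusSite 4 N) s p} → ℂ), ∃ ev wgt : Fin n → ℝ, (∀ i j, ∑ p, star (u i p) * u j p = if i = j then 1 else 0) ∧ (∀ j, (wilsonCell U μ 0 s).mulVec (u j) = fun p => (ev j : ℂ) * gammaFive p.1.2.2 p.1.2.2 * u j p) ∧ (∀ j, |ev j| < 2 * τ ∧ 0 ≤ wgt j ∧ wgt j * |ev j| ≤ 1) ∧ 1 / (2 * τ) < ∑ j, wgt j * ∑ p, if childrenInterior s p then (0 : ℝ) else ‖u j p‖ ^ 2)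
    (h₂ : ∀ (N : ℕ) [NeZero N] (β : ℝ) (Nf : ℕ) (mq : Fin Nf → ℝ) (s : Fin 4 → ℕ) (μv τ χ₀ : ℝ)
      (E : GaugeConfig 4 N (Matrix.specialUnitaryGroup (Fin 3) ℂ) → Prop),
      (∀ U, E U → ∃ n : ℕ, ∃ u : Fin n → ({p // wilsonBox (0 : TorusSite 4 N) s p} → ℂ), ∃ ev wgt : Fin n → ℝ, (∀ i j, ∑ p, star (u i p) * u j p = if i = j then 1 else 0) ∧ (∀ j, (wilsonCell U μv 0 s).mulVec (u j) = fun p => (ev j : ℂ) * gammaFive p.1.2.2 p.1.2.2 * u j p) ∧ (∀ j, |ev j| < 2 * τ ∧ 0 ≤ wgt j ∧ wgt j * |ev j| ≤ 1) ∧ 1 / (2 * τ) < ∑ j, wgt j * ∑ p, if childrenInterior s p then (0 : ℝ) else ‖u j p‖ ^ 2) →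
      (∫ U : GaugeConfig 4 N (Matrix.specialUnitaryGroup (Fin 3) ℂ), (if (E U) then (1 : ℝ) else 0) * ∏ f, ‖fermionDet (wilsonDirac (fundamentalRep (Fin 3)) U (mq f) 1)‖ ∂(wilsonMeasure (fundamentalRep (Fin 3)) β)) /
      (∫ U : GaugeConfig 4 N (Matrix.specialUnitaryGroup (Fin 3) ℂ), ∏ f, ‖fermionDet (wilsonDirac (fundamentalRep (Fin 3)) U (mq f) 1)‖ ∂(wilsonMeasure (fundamentalRep (Fin 3)) β)) ≤
      (∫ U : GaugeConfig 4 N (Matrix.specialUnitaryGroup (Fin 3) ℂ), (if (∃ n : ℕ, ∃ u : Fin n → ({p // wilsonBox (0 : TorusSite 4 N) s p} → ℂ), ∃ ev wgt : Fin n → ℝ, (∀ i j, ∑ p, star (u i p) * u j p = if i = j then 1 else 0) ∧ (∀ j, (wilsonCell U μv 0 s).mulVec (u j) = fun p => (ev j : ℂ) * gammaFive p.1.2.2 p.1.2.2 * u j p) ∧ (∀ j, |ev j| < 2 * τ ∧ 0 ≤ wgt j ∧ wgt j * |ev j| ≤ 1) ∧ (∀ j, χ₀ ≤ ‖∑ p,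 star (u j p) * gammaFive p.1.2.2 p.1.2.2 * u j p‖) ∧ 1 / (4 * τ) < ∑ j, wgt j * ∑ p, if childrenInterior s p then (0 : ℝ) else ‖u j p‖ ^ 2) then (1 : ℝ) else 0) * ∏ f, ‖fermionDet (wilsonDirac (fundamentalRep (Fin 3)) U (mq f) 1)‖ ∂(wilsonMeasure (fundamentalRep (Fin 3)) β)) /
      (∫ U : GaugeConfig 4 N (Matrix.specialUnitaryGroup (Fin 3) ℂ), ∏ f, ‖fermionDet (wilsonDirac (fundamentalRep (Fin 3)) U (mq f) 1)‖ ∂(wilsonMeasure (fundamentalRep (Fin 3)) β)) +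
      (∫ U : GaugeConfig 4 N (Matrix.specialUnitaryGroup (Fin 3) ℂ), (if (∃ n : ℕ, ∃ u : Fin n → ({p // wilsonBox (0 : TorusSite 4 N) s p} → ℂ), ∃ ev wgt : Fin n → ℝ, (∀ i j, ∑ p, star (u i p) * u j p = if i = j then 1 else 0) ∧ (∀ j, (wilsonCell U μv 0 s).mulVec (u j) = fun p => (ev j : ℂ) * gammaFive p.1.2.2 p.1.2.2 * u j p) ∧ (∀ j, |ev j| < 2 * τ ∧ 0 ≤ wgt j ∧ wgt j * |ev j| ≤ 1) ∧ (∀ j, ‖∑ p, star (u j p) * gammaFive p.1.2.2 p.1.2.2 * u j p‖ < χ₀) ∧ 1 / (4 * τ) < ∑ j, wgt j * ∑ p, if childrenInterior s p then (0 : ℝ) else ‖u j p‖ ^ 2) then (1 : ℝ) else 0) * ∏ f, ‖fermionDet (wilsonDirac (fundamentalRep (Fin 3)) U (mq f) 1)‖ ∂(wilsonMeasure (fundamentalRep (Fin 3)) β)) /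
      (∫ U : GaugeConfig 4 N (Matrix.specialUnitaryGroup (Fin 3) ℂ), ∏ f, ‖fermionDet (wilsonDirac (fundamentalRep (Fin 3)) U (mq f) 1)‖ ∂(wilsonMeasure (fundamentalRep (Fin 3)) β)))
    (h₄ : ∀ (Nf : ℕ) (reg : QCDRegularisation Nf), (Nf = 2 ∨ Nf = 3) → reg.HasMassScaling →
      (reg.scheme 0 0 0).HasAsymptoticScaling → ∀ M₀ : ℝ, 0 ≤ M₀ → ∀ b₀ : ℕ, 2 ≤ b₀ → ∀ ℓ : ℝ, 0 < ℓ →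
      (∀ m : Fin Nf → ℝ, (∀ f, M₀ < m f) → ∃ R : ℝ, 0 < R ∧ (∀ ε : ℝ, 0 < ε → ∀ᶠ k : ℕ in Filter.atTop, ∀ S : ℕ, R ≤ reg.a k * (2 * S + 1) → let N : ℕ := 2 * S + 1; let mq : Fin Nf → ℝ := fun f => reg.mcrit k + reg.a k * m f / reg.Zm k; let wt : GaugeConfig 4 N (Matrix.specialUnitaryGroup (Fin 3) ℂ) → ℝ := fun U => ∏ f, ‖fermionDet (wilsonDirac (fundamentalRep (Fin 3)) U (mq f) 1)‖; let P : (GaugeConfig 4 N (Matrix.specialUnitaryGroup (Fin 3) ℂ) → Prop) → ℝ := fun E => (∫ U, (if E U then (1 : ℝ) else 0) * wt U ∂(wilsonMeasure (d := 4) (L := N) (fundamentalRep (Fin 3)) (reg.β k))) / (∫ U, wt U ∂(wilsonMeasure (d := 4) (L := N) (fundamentalRep (Fin 3)) (reg.β k))); let J : ℕ := Nat.log 2 (⌊ℓ / reg.a k⌋₊ / b₀) + 1; ∃ δ : ℕ → ℝ, ∑ j ∈ Finset.range J, δ j ≤ ε ∧ ∀ j < J, ∀ s : Fin 4 → ℕ,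 (∀ i, b₀ * 2 ^ j ≤ s i ∧ s i < b₀ * 2 ^ (j + 2) ∧ s i ≤ N ∧ (s i : ℝ) * reg.a k ≤ ℓ) → P (fun U => ∃ f, IsSignDefect U (mq f) j s) ≤ δ j) ∧ (∀ M : ℝ, M₀ < M → ∀ᶠ k : ℕ in Filter.atTop, ∀ S : ℕ, R ≤ reg.a k * (2 * S + 1) → let N : ℕ := 2 * S + 1; let mq : Fin Nf → ℝ := fun f => reg.mcrit k + reg.a k * m f / reg.Zm k; let wt : GaugeConfig 4 N (Matrix.specialUnitaryGroup (Fin 3) ℂ) → ℝ := fun U => ∏ f, ‖fermionDet (wilsonDirac (fundamentalRep (Fin 3)) U (mq f) 1)‖; (1 / 4 : ℝ) ≤ (∫ U, (if (fermionDet (wilsonDirac (fundamentalRep (Fin 3)) U (reg.mcrit k - reg.a k * M / reg.Zm k) 1)).re < 0 then (1 : ℝ) else 0) * wt U ∂(wilsonMeasure (d := 4) (L := N) (fundamentalRep (Fin 3)) (reg.β k))) / (∫ U, wt U ∂(wilsonMeasure (d := 4) (L := N) (fundamentalRep (Fin 3)) (reg.β k))))) →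
      ∃ M₁ : ℝ, M₀ ≤ M₁ ∧ ∀ χ₀ : ℝ, 0 < χ₀ → χ₀ ≤ 1 → ∀ m : Fin Nf → ℝ, (∀ f, M₁ < m f) →
      ∃ R : ℝ, 0 < R ∧ ∃ C : ℝ, 0 < C ∧ ∃ α : ℝ, 0 < α ∧ ∀ᶠ k : ℕ in Filter.atTop, ∀ S : ℕ, R ≤ reg.a k * (2 * S + 1) → let N : ℕ := 2 * S + 1; let mq : Fin Nf → ℝ := fun f => reg.mcrit k + reg.a k * m f / reg.Zm k; let wt : GaugeConfig 4 N (Matrix.specialUnitaryGroup (Fin 3) ℂ) → ℝ := fun U => ∏ f, ‖fermionDet (wilsonDirac (fundamentalRep (Fin 3)) U (mq f) 1)‖; let P : (GaugeConfig 4 N (Matrix.specialUnitaryGroup (Fin 3) ℂ) → Prop) → ℝ := fun E => (∫ U, (if E U then (1 : ℝ) else 0) * wt U ∂(wilsonMeasure (d := 4) (L := N) (fundamentalRep (Fin 3)) (reg.β k))) / (∫ U, wt U ∂(wilsonMeasure (d := 4) (L := N) (fundamentalRep (Fin 3)) (reg.β k))); ∀ s : Fin 4 → ℕ, (∀ i,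 b₀ ≤ s i ∧ s i ≤ N ∧ (s i : ℝ) * reg.a k ≤ ℓ) → (∀ i j, s i ≤ 2 * s j) → ∀ f : Fin Nf, ∀ t : ℝ, 0 < t → t ≤ 1 → P (fun U => ∃ n : ℕ, ∃ u : Fin n → ({p // wilsonBox (0 : TorusSite 4 N) s p} → ℂ), ∃ ev wgt : Fin n → ℝ, (∀ i j, ∑ p, star (u i p) * u j p = if i = j then 1 else 0) ∧ (∀ j, (wilsonCell U (mq f) 0 s).mulVec (u j) = fun p => (ev j : ℂ) * gammaFive p.1.2.2 p.1.2.2 * u j p) ∧ (∀ j, |ev j| < 2 * (t / s 0) ∧ 0 ≤ wgt j ∧ wgt j * |ev j| ≤ 1) ∧ (∀ j, χ₀ ≤ ‖∑ p, star (u j p) * gammaFive p.1.2.2 p.1.2.2 * u j p‖) ∧ 1 / (4 * (t / s 0)) < ∑ j, wgt j * ∑ p, if childrenInterior s p then (0 : ℝ) else ‖u j p‖ ^ 2) ≤ C * t ^ α)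
    (h₅ : ∀ (Nf : ℕ) (reg : QCDRegularisation Nf), (Nf = 2 ∨ Nf = 3) → reg.HasMassScaling →
      (reg.scheme 0 0 0).HasAsymptoticScaling → ∀ M₀ : ℝ, 0 ≤ M₀ → ∀ b₀ : ℕ, 2 ≤ b₀ → ∀ ℓ : ℝ, 0 < ℓ →
      (∀ m : Fin Nf → ℝ, (∀ f, M₀ < m f) → ∃ R : ℝ, 0 < R ∧ (∀ ε : ℝ, 0 < ε → ∀ᶠ k : ℕ in Filter.atTop, ∀ S : ℕ, R ≤ reg.a k * (2 * S + 1) → let N : ℕ := 2 * S + 1; let mq : Fin Nf → ℝ := fun f => reg.mcrit k + reg.a k * m f / reg.Zm k; let wt : GaugeConfig 4 N (Matrix.specialUnitaryGroup (Fin 3) ℂ) → ℝ := fun U => ∏ f, ‖fermionDet (wilsonDirac (fundamentalRep (Fin 3)) U (mq f) 1)‖; let P : (GaugeConfig 4 N (Matrix.specialUnitaryGroup (Fin 3) ℂ) → Prop) → ℝ := fun E => (∫ U, (if E U then (1 : ℝ) else 0) * wt U ∂(wilsonMeasure (d := 4) (L := N) (fundamentalRep (Fin 3)) (reg.β k)))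 / (∫ U, wt U ∂(wilsonMeasure (d := 4) (L := N) (fundamentalRep (Fin 3)) (reg.β k))); let J : ℕ := Nat.log 2 (⌊ℓ / reg.a k⌋₊ / b₀) + 1; ∃ δ : ℕ → ℝ, ∑ j ∈ Finset.range J, δ j ≤ ε ∧ ∀ j < J, ∀ s : Fin 4 → ℕ, (∀ i, b₀ * 2 ^ j ≤ s i ∧ s i < b₀ * 2 ^ (j + 2) ∧ s i ≤ N ∧ (s i : ℝ) * reg.a k ≤ ℓ) → P (fun U => ∃ f, IsSignDefect U (mq f) j s) ≤ δ j) ∧ (∀ M : ℝ, M₀ < M → ∀ᶠ k : ℕ in Filter.atTop, ∀ S : ℕ, R ≤ reg.a k * (2 * S + 1) → let N : ℕ := 2 * S + 1; let mq : Fin Nf → ℝ := fun f => reg.mcrit k + reg.a k * m f / reg.Zm k; let wt : GaugeConfig 4 N (Matrix.specialUnitaryGroup (Fin 3) ℂ) → ℝ := fun U => ∏ f, ‖fermionDet (wilsonDirac (fundamentalRep (Fin 3)) U (mq f) 1)‖; (1 / 4 : ℝ) ≤ (∫ U, (if (fermionDet (wilsonDirac (fundamentalRep (Fin 3)) U (reg.mcrit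 k - reg.a k * M / reg.Zm k) 1)).re < 0 then (1 : ℝ) else 0) * wt U ∂(wilsonMeasure (d := 4) (L := N) (fundamentalRep (Fin 3)) (reg.β k))) / (∫ U, wt U ∂(wilsonMeasure (d := 4) (L := N) (fundamentalRep (Fin 3)) (reg.β k))))) →
      ∃ M₁ : ℝ, M₀ ≤ M₁ ∧ ∃ χ₀ : ℝ, 0 < χ₀ ∧ χ₀ ≤ 1 ∧ ∀ m : Fin Nf → ℝ, (∀ f, M₁ < m f) →
      ∃ R : ℝ, 0 < R ∧ ∃ C : ℝ, 0 < C ∧ ∃ α : ℝ, 0 < α ∧ ∀ᶠ k : ℕ in Filter.atTop, ∀ S : ℕ, R ≤ reg.a k * (2 * S + 1) → let N : ℕ := 2 * S + 1; let mq : Fin Nf → ℝ := fun f => reg.mcrit k + reg.a k * m f / reg.Zm k; let wt : GaugeConfig 4 N (Matrix.specialUnitaryGroup (Fin 3) ℂ) → ℝ := fun U => ∏ f, ‖fermionDet (wilsonDirac (fundamentalRep (Fin 3)) U (mq f) 1)‖; let P : (GaugeConfig 4 N (Matrix.specialUnitaryGroup (Fin 3) ℂ) → Prop) → ℝ := fun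 E => (∫ U, (if E U then (1 : ℝ) else 0) * wt U ∂(wilsonMeasure (d := 4) (L := N) (fundamentalRep (Fin 3)) (reg.β k))) / (∫ U, wt U ∂(wilsonMeasure (d := 4) (L := N) (fundamentalRep (Fin 3)) (reg.β k))); ∀ s : Fin 4 → ℕ, (∀ i, b₀ ≤ s i ∧ s i ≤ N ∧ (s i : ℝ) * reg.a k ≤ ℓ) → (∀ i j, s i ≤ 2 * s j) → ∀ f : Fin Nf, ∀ t : ℝ, 0 < t → t ≤ 1 → P (fun U => ∃ n : ℕ, ∃ u : Fin n → ({p // wilsonBox (0 : TorusSite 4 N) s p} → ℂ), ∃ ev wgt : Fin n → ℝ, (∀ i j, ∑ p, star (u i p) * u j p = if i = j then 1 else 0) ∧ (∀ j, (wilsonCell U (mq f) 0 s).mulVec (u j) = fun p => (ev j : ℂ) * gammaFive p.1.2.2 p.1.2.2 * u j p) ∧ (∀ j, |ev j| < 2 * (t / s 0) ∧ 0 ≤ wgt j ∧ wgt j * |ev j| ≤ 1) ∧ (∀ j, ‖∑ p, star (u j p) * gammaFive p.1.2.2 p.1.2.2 * u j p‖ < χ₀) ∧ 1 / (4 * (t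 / s 0)) < ∑ j, wgt j * ∑ p, if childrenInterior s p then (0 : ℝ) else ‖u j p‖ ^ 2) ≤ C * t ^ α) :
    CoerciveOfDilute := by
  refine coerciveOfDilute_of_separatorWegnerLaw fun Nf reg hNf hms has M₀ hM₀ b₀ hb₀ ℓ hℓ hm => ?_
  obtain ⟨MA, -, hA⟩ := h₄ Nf reg hNf hms has M₀ hM₀ b₀ hb₀ ℓ hℓ hm
  obtain ⟨MB, -, χ₀, hχ₀, hχ₁, hB⟩ := h₅ Nf reg hNf hms has M₀ hM₀ b₀ hb₀ ℓ hℓ hm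
  refine ⟨max MA MB, ℓ, hℓ, fun m hmm => ?_⟩
  have hmA : ∀ f, MA < m f := fun f => (le_max_left _ _).trans_lt (hmm f)
  have hmB : ∀ f, MB < m f := fun f => (le_max_right _ _).trans_lt (hmm f)
  obtain ⟨RA, -, CA, hCA, αA, hαA, hAk⟩ := hA χ₀ hχ₀ hχ₁ m hmA
  obtain ⟨RB, -, CB, hCB, αB, hαB, hBk⟩ := hB m hmB
  refine ⟨max RA RB, CA + CB, min αA αB, 1, lt_min hαA hαB, one_pos, ?_⟩
  filter_upwards [hAk, hBk] with k hkA hkB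
  intro S hS
  have hA' := hkA S ((le_max_left _ _).trans hS)
  have hB' := hkB S ((le_max_right _ _).trans hS)
  dsimp only at hA' hB' ⊢
  intro s hs hcub f t ht0 ht1
  have hs0 : (0 : ℝ) < (s 0 : ℝ) := by
    have h2 : 2 ≤ s 0 := hb₀.trans (hs 0).1
    exact_mod_cast lt_of_lt_of_le (by norm_num : (0 : ℕ) < 2) h2
  have hτ : 0 < t / (s 0 : ℝ) := div_pos ht0 hs0
  -- pointwise pile-up (stub 1) fed to the domination step (stub 2)
  have hdom := h₂ (2 * S + 1) (reg.β k) Nf (fun f' => reg.mcrit k + reg.a k * m f' / reg.Zm k) s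
    (reg.mcrit k + reg.a k * m f / reg.Zm k) (t / (s 0 : ℝ)) χ₀
    (fun U => HasSingularSeparator U (reg.mcrit k + reg.a k * m f / reg.Zm k) s (t / (s 0 : ℝ)))
    (fun U hU => h₁ (2 * S + 1) U s (reg.mcrit k + reg.a k * m f / reg.Zm k) (t / (s 0 : ℝ)) hU hτ)
  have hAt := hA' s hs hcub f t ht0 ht1
  have hBt := hB' s hs hcub f t ht0 ht1
  -- the two power laws combine on `(0, 1]`
  have hpA : t ^ αA ≤ t ^ min αA αB := Real.rpow_le_rpow_of_exponent_ge ht0 ht1 (min_le_left _ _)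
  have hpB : t ^ αB ≤ t ^ min αA αB := Real.rpow_le_rpow_of_exponent_ge ht0 ht1 (min_le_right _ _)
  calc _ ≤ _ := hdom
    _ ≤ CA * t ^ αA + CB * t ^ αB := add_le_add hAt hBt
    _ ≤ (CA + CB) * t ^ min αA αB := by
        rw [add_mul]
        exact add_le_add (mul_le_mul_of_nonneg_left hpA hCA.le) (mul_le_mul_of_nonneg_left hpB hCB.le)

end Summit.QuantumFields.QCD.Theorems.NestedDissectionSeaCoerciveOfDilute

end
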